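import Mathlib

/-!
# The Gibbs variational bound for a finite free energy  [folklore]

For a finite index type `ι`, real "energies" `V i`, a probability vector `P`
(`0 ≤ P i`, `∑ i, P i = 1`) and an inverse temperature `s > 0`,

  `-(1/s) * log (∑ i, exp (-s * V i)) ≤ ∑ i, P i * V i + (1/s) * ∑ i, P i * log (P i)`,

i.e. the free energy is at most "mean energy minus entropy / s" for EVERY trial law `P`
(equality for the Gibbs law).  With `P` a point mass this is `F ≤ min V`; with `P` uniform it is
`F ≤ average V - log |ι| / s`.

This is the inequality behind the STOCHASTIC-FLAG form of the flag-box bound in the repair cell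
b2b-imbrie (seat 2, DENSITY-XY.md ADDENDUM G.59, THEOREM G″): the flag free energy
`F_{s,C}(w) = -(1/s) log ∑_σ exp (-s V^{(C)}_σ(w))` over the `n!` flags is bounded by the mean
up-variation minus the entropy of any random flag, in particular of the sequential Christoffel
sampler.  Elementary (Jensen for `log`); tagged folklore.  `Real.log 0 = 0` makes the convention
`0 · log 0 = 0` automatic.

We also record the two finite-sum identities used with it there: the expansion of a weighted sum
of squares about a point, the "two independent copies" identity
`∑_i ρ_i ∑_j ρ_j (x_j - x_i)² = 2 Var_ρ(x)` for a probability vector `ρ` (in G.59 this is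
`E[M_k | S_{k-1}] = 2 Var(ρ_{S_{k-1}})` for the sequential Christoffel sampler), and the minimality
of the variance among weighted mean square deviations (`M_k ≥ Var`).
-/

open Finset Real

namespace Literature.MathematicalPhysics.QuantumLattice.Imbrie2016

/-- [folklore] Dropping the indices where the weight vanishes does not change a `P`-weighted sum. -/
theorem sum_filter_weight_ne_zero {ι : Type*} [Fintype ι] [DecidableEq ι] (P g : ι → ℝ) :
    ∑ i ∈ univ.filter (fun i => P i ≠ 0), P i * g i = ∑ i, P i * g i := by
  apply Finset.sum_filter_of_ne
  intro i _ h
  exact left_ne_zero_of_mul h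

/-- [folklore] **Gibbs variational bound** (finite form): for every probability vector `P` and
`s > 0`, `-(1/s) log ∑ exp(-s V) ≤ ∑ P V + (1/s) ∑ P log P`. -/
theorem gibbs_variational {ι : Type*} [Fintype ι] [DecidableEq ι] (V P : ι → ℝ)
    (hP0 : ∀ i, 0 ≤ P i) (hP1 : ∑ i, P i = 1) {s : ℝ} (hs : 0 < s) :
    -(1 / s) * Real.log (∑ i, Real.exp (-s * V i))
      ≤ ∑ i, P i * V i + (1 / s) * ∑ i, P i * Real.log (P i) := by
  set t : Finset ι := univ.filter (fun i => P i ≠ 0) with ht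
  have hpos : ∀ i ∈ t, 0 < P i := by
    intro i hi
    have hne : P i ≠ 0 := (Finset.mem_filter.mp hi).2
    exact lt_of_le_of_ne (hP0 i) (Ne.symm hne)
  -- the weights restricted to `t` still sum to one
  have hsum_t : ∑ i ∈ t, P i = 1 := by
    have h := sum_filter_weight_ne_zero P (fun _ => (1 : ℝ))
    simp only [mul_one] at h
    rw [ht, h, hP1]
  -- `t` is nonempty
  have htne : t.Nonempty := by
    by_contra h
    rw [Finset.not_nonempty_iff_eq_empty] at h
    rw [h, Finset.sum_empty] at hsum_t
    exact zero_ne_one hsum_t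
  -- Jensen for the concave function `log` on `(0, ∞)` with weights `P` and points `exp(-s V i) / P i`
  have hJ := (strictConcaveOn_log_Ioi.concaveOn).le_map_sum
    (t := t) (w := P) (p := fun i => Real.exp (-s * V i) / P i)
    (fun i hi => (hpos i hi).le) hsum_t
    (fun i hi => Set.mem_Ioi.mpr (div_pos (Real.exp_pos _) (hpos i hi)))
  simp only [smul_eq_mul] at hJ
  -- left side of Jensen: `∑_t P i * log (exp(-s V i)/P i) = -s ∑ P V - ∑ P log P`
  have hL : ∑ i ∈ t, P i * Real.log (Real.exp (-s * V i) / P i)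
      = -s * ∑ i, P i * V i - ∑ i, P i * Real.log (P i) := by
    have h1 : ∀ i ∈ t, P i * Real.log (Real.exp (-s * V i) / P i)
        = P i * (-s * V i) - P i * Real.log (P i) := by
      intro i hi
      rw [Real.log_div (Real.exp_pos _).ne' (hpos i hi).ne', Real.log_exp]
      ring
    rw [Finset.sum_congr rfl h1, Finset.sum_sub_distrib]
    have h2 : ∑ i ∈ t, P i * (-s * V i) = ∑ i, P i * (-s * V i) :=
      sum_filter_weight_ne_zero P (fun i => -s * V i)
    have h3 : ∑ i ∈ t, P i * Real.log (P i) = ∑ i, P i * Real.log (P i) :=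
      sum_filter_weight_ne_zero P (fun i => Real.log (P i))
    rw [h2, h3]
    have h4 : ∑ i, P i * (-s * V i) = -s * ∑ i, P i * V i := by
      rw [Finset.mul_sum]; apply Finset.sum_congr rfl; intro i _; ring
    rw [h4]
  -- right side of Jensen: `∑_t P i * (exp(-s V i)/P i) = ∑_t exp(-s V i) ≤ Z`
  have hR : ∑ i ∈ t, P i * (Real.exp (-s * V i) / P i) = ∑ i ∈ t, Real.exp (-s * V i) := by
    apply Finset.sum_congr rfl
    intro i hi
    field_simp [(hpos i hi).ne']
  have hZt_pos : 0 < ∑ i ∈ t, Real.exp (-s * V i) :=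
    Finset.sum_pos (fun i _ => Real.exp_pos _) htne
  have hZt_le : ∑ i ∈ t, Real.exp (-s * V i) ≤ ∑ i, Real.exp (-s * V i) :=
    Finset.sum_le_sum_of_subset_of_nonneg (Finset.filter_subset _ _)
      (fun i _ _ => (Real.exp_pos _).le)
  have key : -s * ∑ i, P i * V i - ∑ i, P i * Real.log (P i)
      ≤ Real.log (∑ i, Real.exp (-s * V i)) := by
    rw [← hL]
    refine le_trans hJ ?_
    rw [hR]
    exact Real.log_le_log hZt_pos hZt_le
  -- divide by `s`
  have hs' : 0 < 1 / s := by positivity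
  calc -(1 / s) * Real.log (∑ i, Real.exp (-s * V i))
      = (1 / s) * (-Real.log (∑ i, Real.exp (-s * V i))) := by ring
    _ ≤ (1 / s) * (s * ∑ i, P i * V i + ∑ i, P i * Real.log (P i)) := by
        apply mul_le_mul_of_nonneg_left _ hs'.le
        linarith
    _ = ∑ i, P i * V i + (1 / s) * ∑ i, P i * Real.log (P i) := by
        field_simp

/-- [folklore] The free energy is at most the minimum energy (`P` = point mass at `j`). -/
theorem free_energy_le {ι : Type*} [Fintype ι] (V : ι → ℝ) (j : ι) {s : ℝ} (hs : 0 < s) :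
    -(1 / s) * Real.log (∑ i, Real.exp (-s * V i)) ≤ V j := by
  have h1 : Real.exp (-s * V j) ≤ ∑ i, Real.exp (-s * V i) :=
    Finset.single_le_sum (fun i _ => (Real.exp_pos (-s * V i)).le) (Finset.mem_univ j)
  have h2 : -s * V j ≤ Real.log (∑ i, Real.exp (-s * V i)) := by
    rw [← Real.log_exp (-s * V j)]
    exact Real.log_le_log (Real.exp_pos _) h1
  have hs' : 0 < 1 / s := by positivity
  calc -(1 / s) * Real.log (∑ i, Real.exp (-s * V i))
      = (1 / s) * (-Real.log (∑ i, Real.exp (-s * V i))) := by ring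
    _ ≤ (1 / s) * (s * V j) := by
        apply mul_le_mul_of_nonneg_left _ hs'.le
        linarith
    _ = V j := by field_simp

/-- [folklore] Counting form: if at least `N ≥ 1` indices have energy `≤ E`, then
`-(1/s) log ∑ exp(-s V) ≤ E - log N / s` (many good flags lower the free energy by their entropy). -/
theorem free_energy_le_of_count {ι : Type*} [Fintype ι] (V : ι → ℝ) {s E : ℝ} (hs : 0 < s)
    (A : Finset ι) (hA : A.Nonempty) (hE : ∀ i ∈ A, V i ≤ E) :
    -(1 / s) * Real.log (∑ i, Real.exp (-s * V i)) ≤ E - Real.log (A.card) / s := by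
  have hcard : (0 : ℝ) < A.card := by exact_mod_cast Finset.card_pos.mpr hA
  -- `N * exp(-s E) ≤ ∑_A exp(-s V) ≤ Z`
  have h1 : (A.card : ℝ) * Real.exp (-s * E) ≤ ∑ i ∈ A, Real.exp (-s * V i) := by
    have : ∑ i ∈ A, Real.exp (-s * E) = (A.card : ℝ) * Real.exp (-s * E) := by
      rw [Finset.sum_const, nsmul_eq_mul]
    rw [← this]
    apply Finset.sum_le_sum
    intro i hi
    apply Real.exp_le_exp.mpr
    have := hE i hi
    nlinarith
  have h2 : ∑ i ∈ A, Real.exp (-s * V i) ≤ ∑ i, Real.exp (-s * V i) :=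
    Finset.sum_le_sum_of_subset_of_nonneg (Finset.subset_univ A) (fun i _ _ => (Real.exp_pos _).le)
  have h3 : Real.log ((A.card : ℝ) * Real.exp (-s * E)) ≤ Real.log (∑ i, Real.exp (-s * V i)) :=
    Real.log_le_log (mul_pos hcard (Real.exp_pos _)) (le_trans h1 h2)
  rw [Real.log_mul hcard.ne' (Real.exp_pos _).ne', Real.log_exp] at h3
  have hs' : 0 < 1 / s := by positivity
  calc -(1 / s) * Real.log (∑ i, Real.exp (-s * V i))
      = (1 / s) * (-Real.log (∑ i, Real.exp (-s * V i))) := by ring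
    _ ≤ (1 / s) * (s * E - Real.log (A.card)) := by
        apply mul_le_mul_of_nonneg_left _ hs'.le
        linarith
    _ = E - Real.log (A.card) / s := by
        field_simp


/-- [folklore] Expansion of a weighted sum of squares about a point `c`. -/
theorem weighted_sq_expand {ι : Type*} [Fintype ι] (ρ x : ι → ℝ) (c : ℝ) :
    ∑ i, ρ i * (x i - c) ^ 2
      = ∑ i, ρ i * x i ^ 2 - 2 * c * ∑ i, ρ i * x i + c ^ 2 * ∑ i, ρ i := by
  simp only [Finset.mul_sum]
  rw [← Finset.sum_sub_distrib, ← Finset.sum_add_distrib]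
  apply Finset.sum_congr rfl
  intro i _
  ring

/-- [folklore] **Two independent copies**: for a probability vector `ρ`, the `ρ ⊗ ρ`-mean of
`(x j - x i)²` is twice the variance of `x` under `ρ`.  In the flag-box problem this is the identity
`E[M_k | S_{k-1}] = 2 Var(ρ_{S_{k-1}})` for the sequential Christoffel sampler (DENSITY-XY G.59(c)). -/
theorem mean_sq_dist_eq_two_var {ι : Type*} [Fintype ι] (ρ x : ι → ℝ) (h1 : ∑ i, ρ i = 1) :
    ∑ i, ρ i * ∑ j, ρ j * (x j - x i) ^ 2
      = 2 * ∑ j, ρ j * (x j - ∑ i, ρ i * x i) ^ 2 := by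
  have hL : ∀ i, ∑ j, ρ j * (x j - x i) ^ 2
      = ∑ j, ρ j * x j ^ 2 - 2 * x i * ∑ j, ρ j * x j + x i ^ 2 * ∑ j, ρ j :=
    fun i => weighted_sq_expand ρ x (x i)
  rw [Finset.sum_congr rfl (fun i _ => by rw [hL i]), weighted_sq_expand ρ x (∑ i, ρ i * x i), h1]
  set S1 := ∑ i, ρ i * x i with hS1
  set S2 := ∑ i, ρ i * x i ^ 2 with hS2
  have h3 : ∑ i, ρ i * (S2 - 2 * x i * S1 + x i ^ 2 * 1) = S2 * ∑ i, ρ i - 2 * S1 * S1 + S2 := by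
    have : ∀ i, ρ i * (S2 - 2 * x i * S1 + x i ^ 2 * 1) = S2 * ρ i - 2 * S1 * (ρ i * x i) + ρ i * x i ^ 2 := by
      intro i; ring
    rw [Finset.sum_congr rfl (fun i _ => this i), Finset.sum_add_distrib, Finset.sum_sub_distrib,
      ← Finset.mul_sum, ← Finset.mul_sum, ← hS1, ← hS2]
  rw [h3, h1]
  ring

/-- [folklore] The variance is the least weighted mean square deviation: for every centre `c`,
`∑ ρ (x - mean)² ≤ ∑ ρ (x - c)²` (so each `M(ξ) = ∑ ρ (x - ξ)² ≥ Var(ρ)`; no sign condition on `ρ`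
is needed, only `∑ ρ = 1`). -/
theorem var_le_mean_sq_dist {ι : Type*} [Fintype ι] (ρ x : ι → ℝ)
    (h1 : ∑ i, ρ i = 1) (c : ℝ) :
    ∑ j, ρ j * (x j - ∑ i, ρ i * x i) ^ 2 ≤ ∑ j, ρ j * (x j - c) ^ 2 := by
  rw [weighted_sq_expand ρ x c, weighted_sq_expand ρ x (∑ i, ρ i * x i), h1]
  set S1 := ∑ i, ρ i * x i
  nlinarith [sq_nonneg (S1 - c)]

end Literature.MathematicalPhysics.QuantumLattice.Imbrie2016
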